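import Summits.Langlands.Langlands.Theorems.NonParallelVoidTwistedInductionParallelStubPotentialAutomorphyOfInducedTwist
import Summits.Langlands.Langlands.Theorems.NonParallelVoidTwistedInductionParallelSymmetriseDefsV7
import Summits.Langlands.Langlands.Theorems.TwistedInductionParallel.Negative.HypothesisRedundancy
import Literature.NumberTheory.Automorphic.BLGGT2014PotentialAutomorphyAvoid
import HarnessLib

/-!
# Route `NonParallelVoid`, crux `TwistedInductionParallel` (stmt-Langlands-17000), line `symmetrise-pd-split`:
# stub 3 of skeleton v7 `stub_potentialAutomorphyOfInducedTwistIrr` — BLGGT Theorem C WITH the avoid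
# clause applied to the induced twist, delivering `I|Γ_{K'}` irreducible

Lead prover `prover-line-stmt-Langlands-17000-0`, 2026-08-17.  The v6 stub (`…StubPotentialAutomorphyOfInducedTwist`,
p170004) applies the avoid-free `BLGGT2014_thmC_potentialAutomorphy`; the stub-3' worker's verdict
(`stub-misstated`) is that the Arthur–Clozel descent needs `I|Γ_{K'}` IRREDUCIBLE, which only the avoid
form of Thm. C gives.  This file factors the v6 proof into `thmC_inputs` (hypotheses (1)–(3) of Thm. C
for `I = Ind_E^K(ρ|_E ⊗ χ)`, proof verbatim from the v6 file, whose helper lemmas are imported) and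
applies the named fact `BLGGT2014_thmC_potentialAutomorphy_avoid`: its extra conclusion
"`Ī|_{K'(ζ_p)}` absolutely irreducible" gives the irreducibility of `I|Γ_{K'}`
(`Negative.HypothesisRedundancy.isIrreducible_of_isResiduallyAbsIrreducible_restrictField`), i.e. the v7
waypoint `InducedTwistAutomorphicIrr`.
-/

noncomputable section

open scoped NumberField
open NumberField IsDedekindDomain Field Filter ValuativeRel
open Literature.NumberTheory.GaloisRepresentations Literature.NumberTheory.PAdicHodge
open Literature.NumberTheory.Automorphic

-- `Summit.Langlands.Langlands.…` repeats a namespace component by design (D-0017 nested layout).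
set_option linter.dupNamespace false

namespace Summit.Langlands.Langlands.Cruxes.TwistedInductionParallel.SymmetrisePdSplit

/-! ## 1. Hypotheses (1)–(3) of Theorem C for the induced twist (the v6 proof, factored) -/

/-- **Hypotheses (1) a.e. unramified, (2) symplectic with totally odd multiplier `θ`, (3) the local
clause at `v ∣ p` (de Rham, four distinct labelled weights, non-empty and potentially diagonalizable
extension data) of BLGGT Thm. C for `I = Ind_E^K(ρ|_E ⊗ χ)`** — the body of the v6 proof of stub 3
(`stub_potentialAutomorphyOfInducedTwist`, p170004), factored so that both the avoid-free and the avoid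
form of Thm. C can be applied to it.  [cite: BarnetlambEtAl2014, Theorem C and §1.4]
[cite: Patrikis2019, Lemma 7.2.1] -/
theorem thmC_inputs (hFD : Literature.NumberTheory.PAdicHodge.FontaineDatumExists)
    (hI1 : IsDeRhamFramedInduceSchema) (hI2 : LabelledWeightsInduceSchema) (hP1 : PDRestrictSchema)
    (hP2 : PDTwistSchema) (hP3 : PDInduceSchema) (hR : LabelledWeightsRestrictSchema)
    (hT : LabelledWeightsTwistSchema) (hD : LabelledWeightsDetSchema)
    {F : Type} [Field F] [NumberField F] [Algebra.IsQuadraticExtension ℚ F] [IsTotallyComplex F]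
    {p : ℕ} [Fact p.Prime] (ρ : FramedGaloisRep F (PadicAlgCl p) 2)
    (hunr : ∀ᶠ v : HeightOneSpectrum (𝓞 F) in cofinite, ρ.IsUnramifiedAt v)
    (hHT : HasTwoWeights F p ρ) (hNP : NonParallelPair F p ρ) (hPD : PDAbove F p ρ)
    {K E : Type} [Field K] [NumberField K] [IsTotallyReal K] [Field E] [NumberField E] [Algebra F E]
    [Algebra K E] (hd : Module.finrank K E = 2) (χ : absoluteGaloisGroup E →ₜ* (PadicAlgCl p)ˣ)
    (θ : absoluteGaloisGroup K →ₜ* (PadicAlgCl p)ˣ) (hLA : IsLocallyAlgebraicAbove p E χ)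
    (hdet : FramedRep.det (FramedRep.twist (ρ.restrictField E) χ) = θ.comp (absGaloisRestrict K E))
    (hodd : FramedGaloisRep.IsOdd
      ((FramedRep.scalar (PadicAlgCl p) 1).comp θ : FramedGaloisRep K (PadicAlgCl p) 1)) :
    (∀ᶠ v : HeightOneSpectrum (𝓞 K) in cofinite,
      (FramedGaloisRep.induce K hd (FramedRep.twist (ρ.restrictField E) χ)).IsUnramifiedAt v) ∧
    (∃ (J : Matrix (Fin (2 * 2)) (Fin (2 * 2)) (PadicAlgCl p)) (μ : absoluteGaloisGroup K →* (PadicAlgCl p)ˣ),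
      J.transpose = -J ∧ IsUnit J.det ∧
      (∀ g : absoluteGaloisGroup K,
        ((FramedGaloisRep.induce K hd (FramedRep.twist (ρ.restrictField E) χ)) g).val.transpose * J *
          ((FramedGaloisRep.induce K hd (FramedRep.twist (ρ.restrictField E) χ)) g).val =
          (μ g : PadicAlgCl p) • J) ∧
      ∀ (φ : K →+* ℝ) (c : absoluteGaloisGroup K), IsComplexConjugation φ c → μ c = -1) ∧
    (∀ (v : HeightOneSpectrum (𝓞 K)) (hv : ((p : ℕ) : 𝓞 K) ∈ v.asIdeal),
      (fontainePstAdicCompletion v p hv).IsDeRhamFramed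
        ((FramedGaloisRep.induce K hd (FramedRep.twist (ρ.restrictField E) χ)).toLocal v) ∧
      (letI := (fontainePstAdicCompletion v p hv).algebra
       (∀ τ : v.adicCompletion K →ₐ[ℚ_[p]] PadicAlgCl p,
          (let M := (FramedGaloisRep.induce K hd (FramedRep.twist (ρ.restrictField E) χ)).labelledHodgeTateWeightsAt v
             (fontainePstAdicCompletion v p hv).algebra
             (fontainePstAdicCompletion v p hv).𝔅 τ.toRingHom
           M.Nodup ∧ Multiset.card M = 2 * 2)) ∧
       Nonempty (PstCrystallineExtensionData (fontainePstAdicCompletion v p hv)) ∧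
       ∀ 𝔈 : PstCrystallineExtensionData (fontainePstAdicCompletion v p hv),
         IsPotentiallyDiagonalizable 𝔈.𝔅
           ((FramedGaloisRep.induce K hd (FramedRep.twist (ρ.restrictField E) χ)).toLocal v))) := by
  set W : FramedGaloisRep E (PadicAlgCl p) 2 := FramedRep.twist (ρ.restrictField E) χ with hWdef
  -- (1) unramified almost everywhere
  have h1 : ∀ᶠ v : HeightOneSpectrum (𝓞 K) in cofinite,
      (FramedGaloisRep.induce K hd W).IsUnramifiedAt v := by
    refine FramedGaloisRep.eventually_isUnramifiedAt_induce K hd W ?_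
    exact FramedGaloisRep.eventually_isUnramifiedAt_twist (ρ.restrictField E) χ
      (FramedGaloisRep.eventually_isUnramifiedAt_restrictField ρ hunr)
      (FramedGaloisRep.eventually_isUnramifiedAt_of_rank_one _)
  -- (2) symplectic with totally odd multiplier
  have h2 := FramedGaloisRep.induce_isSymplecticWithMultiplier_of_det_eq K hd W θ hdet
  obtain ⟨J, hJT, hJdet, hJ⟩ := h2
  -- (3) the local clause
  have h3 : ∀ (v : HeightOneSpectrum (𝓞 K)) (hv : ((p : ℕ) : 𝓞 K) ∈ v.asIdeal),
      (fontainePstAdicCompletion v p hv).IsDeRhamFramed ((FramedGaloisRep.induce K hd W).toLocal v) ∧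
      (letI := (fontainePstAdicCompletion v p hv).algebra
       (∀ τ : v.adicCompletion K →ₐ[ℚ_[p]] PadicAlgCl p,
          (let M := (FramedGaloisRep.induce K hd W).labelledHodgeTateWeightsAt v
             (fontainePstAdicCompletion v p hv).algebra
             (fontainePstAdicCompletion v p hv).𝔅 τ.toRingHom
           M.Nodup ∧ Multiset.card M = 2 * 2)) ∧
       Nonempty (PstCrystallineExtensionData (fontainePstAdicCompletion v p hv)) ∧
       ∀ 𝔈 : PstCrystallineExtensionData (fontainePstAdicCompletion v p hv),
         IsPotentiallyDiagonalizable 𝔈.𝔅 ((FramedGaloisRep.induce K hd W).toLocal v)) := by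
    -- de Rham-ness of `W` above `p`
    have hWdR : ∀ (w : HeightOneSpectrum (𝓞 E)) (hw : ((p : ℕ) : 𝓞 E) ∈ w.asIdeal),
        (fontainePstAdicCompletion w p hw).IsDeRhamFramed (W.toLocal w) := fun w hw =>
      isDeRhamFramed_toLocal_twist_restrictField ρ χ (fun v hv => (hHT v hv).1) hLA w hw
    -- potential diagonalizability of `W` above `p`
    have hWPD : ∀ (w : HeightOneSpectrum (𝓞 E)) (hw : ((p : ℕ) : 𝓞 E) ∈ w.asIdeal)
        (𝔈 : PstCrystallineExtensionData (fontainePstAdicCompletion w p hw)),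
        letI := (fontainePstAdicCompletion w p hw).algebra
        IsPotentiallyDiagonalizable 𝔈.𝔅 (W.toLocal w) := fun w hw =>
      hP2 E p 2 (ρ.restrictField E) χ w hw (hLA w hw)
        (hP1 F E p 2 ρ (w.under (𝓞 F)) (natCast_mem_under (F := F) hw) w hw
          (liesOver_under (F := F) w).over.symm (hPD _ _))
    -- the rank-one avatar of `θ` and the determinant of `W`
    set Θ : FramedGaloisRep K (PadicAlgCl p) 1 := (FramedRep.scalar (PadicAlgCl p) 1).comp θ with hΘdef
    have hΘ : ∀ w : HeightOneSpectrum (𝓞 E),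
        (FramedRep.scalar (PadicAlgCl p) 1).comp (FramedRep.det (W.toLocal w)) =
          (Θ.restrictField E).toLocal w := fun w => by
      refine ContinuousMonoidHom.ext fun g => ?_
      have := congrArg (fun f : absoluteGaloisGroup E →ₜ* (PadicAlgCl p)ˣ =>
        f (absGaloisRestrict E (w.adicCompletion E) g)) hdet
      change FramedRep.scalar (PadicAlgCl p) 1 (FramedRep.det W (absGaloisRestrict E (w.adicCompletion E) g)) =
        FramedRep.scalar (PadicAlgCl p) 1 (θ (absGaloisRestrict K E (absGaloisRestrict E (w.adicCompletion E) g)))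
      rw [this]
      rfl
    have hF2 : Module.finrank ℚ F = 2 := Algebra.IsQuadraticExtension.finrank_eq_two (R := ℚ) (S := F)
    intro v hv
    refine ⟨hI1 K E 2 hd p 2 W hWdR v hv, ?_,
      nonempty_pstCrystallineExtensionData_fontainePstAdicCompletion hFD v p hv,
      hP3 K E 2 hd p 2 W hWPD v hv⟩
    intro τ
    change (labelledHodgeTateWeightsAtLabel (FramedGaloisRep.induce K hd W) v hv τ).Nodup ∧
      Multiset.card (labelledHodgeTateWeightsAtLabel (FramedGaloisRep.induce K hd W) v hv τ) = 2 * 2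
    obtain ⟨w, hw, σ, habove, hinj, hM⟩ := hI2 K E 2 hd p 2 W v hv τ
    -- the weights of `W` at the two labels above `τ`: those of `ρ` below, shifted
    have hWi : ∀ i : Fin 2, ∃ c : ℤ, labelledHodgeTateWeightsAtLabel W (w i) (hw i) (σ i) =
        (labelledHodgeTateWeightsAtLabel ρ ((w i).under (𝓞 F)) (natCast_mem_under (F := F) (hw i))
          ((σ i).below F)).map fun h => h + c := fun i => by
      obtain ⟨k, hk⟩ := hLA (w i) (hw i)
      obtain ⟨c, hc⟩ : ∃ c : ℤ, labelledHodgeTateWeightsAtLabel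
          ((FramedRep.scalar (PadicAlgCl p) 1).comp χ : FramedGaloisRep E (PadicAlgCl p) 1)
          (w i) (hw i) (σ i) = {c} :=
        exists_labelledHodgeTateWeightsAt_eq_singleton_of_inertia_eq_cyclotomic_zpow χ (w i) (hw i) k hk
          (σ i)
      exact ⟨c, labelledHodgeTateWeightsAtLabel_twist_restrictField hR hT ρ χ (σ i) c
        (isDeRhamFramed_toLocal_scalar_comp_of_inertia_eq_cyclotomic_zpow χ (w i) (hw i) k hk) hc⟩
    -- concentricity: the sum of the weights of `W` at `σ i` is the weight of `θ` at `τ`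
    have hsum : ∀ i : Fin 2, ({(labelledHodgeTateWeightsAtLabel W (w i) (hw i) (σ i)).sum} : Multiset ℤ) =
        labelledHodgeTateWeightsAtLabel Θ v hv τ := fun i => by
      haveI := LocalField.charZero_adicCompletion (w i)
      have h := hD p ((w i).adicCompletion E)
        (LocalField.valuation_adicCompletion_natCast_lt_one (w i) p (hw i)) 2 (W.toLocal (w i))
        (hWdR (w i) (hw i)) (σ i)
      rw [hΘ (w i)] at h
      have h' : labelledHodgeTateWeightsAtLabel (Θ.restrictField E) (w i) (hw i) (σ i) =
          {(labelledHodgeTateWeightsAtLabel W (w i) (hw i) (σ i)).sum} := by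
        simp only [labelledHodgeTateWeightsAtLabel, FramedGaloisRep.labelledHodgeTateWeightsAt_def]
        exact h
      rw [← h', labelledHodgeTateWeightsAtLabel_restrictField_below hR Θ (σ i)]
      exact labelledHodgeTateWeightsAtLabel_eq_of_emb_eq Θ _ τ
        (by rw [PinnedLabel.emb_below]; exact habove i)
    have hsum01 : (labelledHodgeTateWeightsAtLabel W (w 0) (hw 0) (σ 0)).sum =
        (labelledHodgeTateWeightsAtLabel W (w 1) (hw 1) (σ 1)).sum :=
      Multiset.singleton_inj.1 ((hsum 0).trans (hsum 1).symm)
    -- the two labels of `F` below have distinct embeddings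
    have hℓne : ((σ 0).below F).emb ≠ ((σ 1).below F).emb := by
      rw [PinnedLabel.emb_below, PinnedLabel.emb_below]
      refine ringHom_comp_ne_of_ne (F := F) hd (fun h => ?_) ((habove 0).trans (habove 1).symm)
      exact absurd (hinj h) (by decide)
    -- the non-parallel pair, and the two embeddings of the quadratic `F`
    obtain ⟨x, hx, y, hy, τx, τy, a, b, a', b', hHx, hab, hHy, hab', hgap⟩ := hNP
    change labelledHodgeTateWeightsAtLabel ρ x hx τx = {a, b} at hHx
    change labelledHodgeTateWeightsAtLabel ρ y hy τy = {a', b'} at hHy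
    have hxy : PinnedLabel.emb (p := p) τx ≠ PinnedLabel.emb (p := p) τy := fun h => by
      have := (hHx.symm.trans (labelledHodgeTateWeightsAtLabel_eq_of_emb_eq ρ τx τy h)).trans hHy
      rcases pair_cases (by simpa [Multiset.insert_eq_cons] using this) with ⟨h1, h2⟩ | ⟨h1, h2⟩ <;> omega
    have hpairs : ∃ A B A' B' : ℤ,
        labelledHodgeTateWeightsAtLabel ρ _ _ ((σ 0).below F) = {A, B} ∧ A < B ∧
        labelledHodgeTateWeightsAtLabel ρ _ _ ((σ 1).below F) = {A', B'} ∧ A' < B' ∧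
        B - A ≠ B' - A' := by
      rcases emb_dichotomy hF2 hxy ((σ 0).below F).emb with h0 | h0 <;>
        rcases emb_dichotomy hF2 hxy ((σ 1).below F).emb with h1 | h1
      · exact absurd (h0.trans h1.symm) hℓne
      · exact ⟨a, b, a', b', (labelledHodgeTateWeightsAtLabel_eq_of_emb_eq ρ _ τx h0).trans hHx, hab,
          (labelledHodgeTateWeightsAtLabel_eq_of_emb_eq ρ _ τy h1).trans hHy, hab', hgap⟩
      · exact ⟨a', b', a, b, (labelledHodgeTateWeightsAtLabel_eq_of_emb_eq ρ _ τy h0).trans hHy, hab',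
          (labelledHodgeTateWeightsAtLabel_eq_of_emb_eq ρ _ τx h1).trans hHx, hab, fun h => hgap h.symm⟩
      · exact absurd (h0.trans h1.symm) hℓne
    obtain ⟨A, B, A', B', h0, hAB, h1, hAB', hgapAB⟩ := hpairs
    obtain ⟨c, hc⟩ := hWi 0
    obtain ⟨c', hc'⟩ := hWi 1
    rw [h0] at hc
    rw [h1] at hc'
    simp only [Multiset.insert_eq_cons, Multiset.map_cons, Multiset.map_singleton] at hc hc'
    rw [hc, hc'] at hsum01
    simp only [Multiset.sum_cons, Multiset.sum_singleton] at hsum01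
    rw [hM, Fin.sum_univ_two, hc, hc', Multiset.cons_add, Multiset.singleton_add]
    refine ⟨nodup_of_concentric_of_gap_ne hAB hAB' hsum01 hgapAB, ?_⟩
    simp
  exact ⟨h1, ⟨J, θ.toMonoidHom, hJT, hJdet, hJ, fun φ c hc => apply_eq_neg_one_of_isOdd_scalar_comp hodd φ c hc⟩, h3⟩

/-! ## 2. The stub of skeleton v7 -/

/-- **STUB 3 (v7) — BLGGT Theorem C with the avoid clause, for the induced twist, delivering the v7
waypoint `InducedTwistAutomorphicIrr`** (`I|Γ_{K'}` irreducible from "`Ī|_{K'(ζ_p)}` absolutely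
irreducible", `isIrreducible_of_isResiduallyAbsIrreducible_restrictField`).
[cite: BarnetlambEtAl2014, Cor. 4.5.2 with Thm. 4.5.1] [cite: PatrikisTaylor2015, proof of Thm. 2.1] -/
theorem stub_potentialAutomorphyOfInducedTwistIrr :
    BLGGT2014_thmC_potentialAutomorphy_avoid → Literature.NumberTheory.PAdicHodge.FontaineDatumExists →
    IsDeRhamFramedInduceSchema → LabelledWeightsInduceSchema → PDRestrictSchema → PDTwistSchema →
    PDInduceSchema → LabelledWeightsRestrictSchema → LabelledWeightsTwistSchema →
    LabelledWeightsDetSchema →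
    ∀ (F : Type) [Field F] [NumberField F] [Algebra.IsQuadraticExtension ℚ F],
      NumberField.IsTotallyComplex F → ∀ (p : ℕ) [Fact p.Prime] (ρ : FramedGaloisRep F (PadicAlgCl p) 2),
      ρ.toGaloisRep.IsIrreducible →
      (∀ᶠ v : IsDedekindDomain.HeightOneSpectrum (NumberField.RingOfIntegers F) in Filter.cofinite,
        ρ.IsUnramifiedAt v) →
      HasTwoWeights F p ρ → GoodRegime F p ρ → NonParallelPair F p ρ → PDAbove F p ρ →
      SymmetrisingTwistDatumLA F p ρ → InducedTwistAutomorphicIrr F p ρ := by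
  intro hC hFD hI1 hI2 hP1 hP2 hP3 hR hT hD F _ _ _ hFtc p _ ρ _hirr hunr hHT hgood hNP hPD hST
  obtain ⟨K, E, _, _, _, _, _, _, hd, hKtr, hEcm, χ, θ, hLA, hθshape, hdet, hodd, hirrI⟩ := hST
  haveI : IsTotallyReal K := hKtr
  haveI : IsTotallyComplex F := hFtc
  obtain ⟨ι⟩ := PadicAlgCl.nonempty_ringEquiv_complex p
  obtain ⟨h1, h2, h3⟩ :=
    thmC_inputs hFD hI1 hI2 hP1 hP2 hP3 hR hT hD ρ hunr hHT hNP hPD hd χ θ hLA hdet hodd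
  have hp10 : 2 * (2 * 2 + 1) ≤ p := by have := hgood.1; omega
  obtain ⟨K', _, _, _, hGal, hK'tr, hss, hres, hcpt, π, hreg, hcompat⟩ :=
    hC K hKtr (2 * 2) (by norm_num) p hp10 ι _ h1 (Or.inl h2) h3 hirrI
  have hirrK' := Summit.Langlands.Langlands.Theorems.TwistedInductionParallel.Negative.isIrreducible_of_isResiduallyAbsIrreducible_restrictField
    (by norm_num : 0 < 2 * 2) (CyclotomicField p K') _ hres
  exact ⟨K, E, inferInstance, inferInstance, inferInstance, inferInstance, inferInstance,
    inferInstance, hd, hKtr, hEcm, χ, θ, hLA, hθshape, hdet, hirrI, K', inferInstance, inferInstance,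
    inferInstance, hGal, hK'tr, ι, hss, hirrK', hcpt, π, hreg, hcompat⟩

end Summit.Langlands.Langlands.Cruxes.TwistedInductionParallel.SymmetrisePdSplit

end
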